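import Summits.ResolutionOfSingularities.ResolutionOfSingularities.Theorems.WildConesCampaignW46HypersurfacesCharTwoFreePoints
import Summits.ResolutionOfSingularities.ResolutionOfSingularities.Theorems.WildConesCampaignW46HypersurfacesCharTwoCubicPolarization

/-!
# [OURS · L1 W4.6, rung (ii) at p = 2, EVERY dimension n, EVERY corank] THE NEAR-POINT DICHOTOMY: an isolated
# double point of `z² = a(u₁,…,uₙ)` over ANY field of characteristic 2 has EITHER at most THREE infinitely-near
# double points, all isolated with smaller Milnor number, OR ONLY NON-ISOLATED infinitely-near double points;
# for order-2-cleaned fourfold double points (`n = 4`) the complete list of cases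

HONEST FRAMING. Everything here is OURS: theorems about route WildCones' own TYPED point-blow-up dynamics
(`Theorems/WildConesClassicalRegimesDefs.lean`) and the seat's invariants `polarMatrix` (p502936),
`milnorEmbDim` (p498937), `milnorHilbertTwo` (p511581), `degForm` (p522667). NOTHING here is a statement of the
manuscript [Hironaka2017]; no FACT-LIST premise; AI review is weaker than expert review. Cell res-hironaka
(LADDER-RESOLUTION rung L, D-0089), slot W4.6, seat res-L1-s46-pv-4 (gen 6); host route `WildCones`, crux
`ClassicalRegimes` (stmt-ResolutionOfSingularities-16884; proved).

THE SYNTHESIS (gens 3–6). Let `c` be an ISOLATED double state, corank `e = e(c)` (`= dim ker P`). The near vectors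
of double successors lie in `ker P` (gen 3). `e = 0`: no double successor at all. `e = 1`: the kernel is a line, at
most ONE near point, and the successor is isolated with `μ − 2` (gen 3). `e = 2`, `h₂ ≤ 2`: at most THREE near points
over every field (p543928) and every double successor is isolated with smaller `μ` (gen 4). `e = 2`, `h₂ = 3`:
every double successor is NON-isolated (gen 4). `e ≥ 3`: every double successor is NON-isolated (gen 3). HENCE THE
DICHOTOMY: either `≤ 3` isolated near double points with `μ`-drop, or only non-isolated ones — the forced point-blow-up
procedure either stays in a finitely-branching isolated world with a strictly decreasing integer, or leaves the
isolated regime at once (sideways exit). For `n = 4` and ORDER-2-CLEANED states (`OrdP`: a hyperbolic pair,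
`e ≤ 2`) this is the complete census of the target class of the slot («n ≥ 3, order-2 cleaned»): `e = 0`
(resolved by one blow-up), `e = 2` with `h₂ ∈ {1, 2}` (`≤ 3` / `≤ 2` near points, p544683) or `h₂ = 3` (exit).

WHAT IS PROVED (every `n`, every field of characteristic `2`):

* `hypersurface_nearPoints_le_one_of_milnorEmbDim_le_one` — double state with `e ≤ 1`: a set `S` of `≤ 1` vectors
  of which every near vector is a multiple (the kernel line);
* `hypersurface_near_dichotomy` — **THE DICHOTOMY** for every isolated double state: (`≤ 3` near double points AND
  every double successor isolated with smaller `μ`) OR (every double successor NON-isolated, and `e ≥ 3` or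
  `(e, h₂) = (2, 3)`);
* `hypersurface_near_census_of_milnorEmbDim_le_two` — the same with the finer count for `e ≤ 2`
  (`e ≤ 1`: `≤ 1`; `(2,1)`: `≤ 3`; `(2,2)`: `≤ 2`);
* `fourfold_ordTwo_near_census` — `n = 4`, order-2-cleaned isolated double points: `e ∈ {0, 2}` and the list above.

References: [CasasAlvero2000] §3 (context only); [GreuelPfister2026] Thm 3.5 / Cor 3.7 (hyperbolic pairs in
characteristic two: context of `e`); [Hironaka2017] Th. 16.6 p.84 — role replaced only, under adjudication.
-/

noncomputable section

-- single-problem summit: the doubled namespace component `ResolutionOfSingularities` is forced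
set_option linter.dupNamespace false

open scoped BigOperators Classical

open MvPowerSeries IsLocalRing

open Literature.AlgebraicGeometry.Resolution

namespace Summit.ResolutionOfSingularities.ResolutionOfSingularities.Theorems

namespace CampaignW46.HypersurfacesCharTwo

open WildCones WildCones.MuDropCharTwoOrdP ThreefoldsCharTwo

variable {κ : Type} [Field κ] {n : ℕ}

/-! ## Corank at most one: at most one near point -/

/-- [OURS · L1 W4.6 rung (ii) at `p = 2`, every dimension; NOT a statement of the manuscript] **CORANK `≤ 1`:
AT MOST ONE NEAR DOUBLE POINT** — for a double state with `e(c) ≤ 1` (any field of characteristic `2`) there is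
a set `S` of at most ONE vector such that the near vector of every double successor is a multiple of a member of
`S` (near vectors lie in the kernel of the polar form, gen 3, which is a line or zero). [folklore] -/
theorem hypersurface_nearPoints_le_one_of_milnorEmbDim_le_one [CharP κ 2] (c : (Fin n → ℕ) → κ)
    (hM : MultP 2 n κ c) (he : milnorEmbDim 2 n κ c ≤ 1) :
    ∃ S : Finset (Fin n → κ), S.card ≤ 1 ∧
      ∀ (i : Fin n) (τ : Fin n → κ), MultP 2 n κ (step 2 n κ i τ c) →
        ∃ w ∈ S, ∃ r : κ, Function.update τ i 1 = r • w := by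
  by_cases hex : ∃ (i : Fin n) (τ : Fin n → κ), MultP 2 n κ (step 2 n κ i τ c)
  · obtain ⟨i₀, τ₀, hM₀⟩ := hex
    have he1 : milnorEmbDim 2 n κ c = 1 := by
      rcases Nat.lt_or_ge (milnorEmbDim 2 n κ c) 1 with h0 | h1
      · exact absurd hM₀ (hypersurface_not_multP_step_of_milnorEmbDim_eq_zero c hM (by omega) i₀ τ₀)
      · omega
    have hk₀ := vecMul_nearPoint_polarMatrix c i₀ τ₀ hM hM₀
    refine ⟨{Function.update τ₀ i₀ 1}, by rw [Finset.card_singleton], fun i τ hM' =>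
      ⟨_, Finset.mem_singleton_self _, ?_⟩⟩
    exact exists_smul_of_ker_of_milnorEmbDim_eq_one hM he1 (update_one_ne_zero τ₀ i₀) hk₀
      (vecMul_nearPoint_polarMatrix c i τ hM hM')
  · exact ⟨∅, by rw [Finset.card_empty]; exact zero_le_one, fun i τ hM' => absurd ⟨i, τ, hM'⟩ hex⟩

/-! ## The dichotomy -/

/-- [OURS · L1 W4.6 rung (ii) at `p = 2`, EVERY dimension `n`, EVERY corank, EVERY field of characteristic `2`;
NOT a statement of the manuscript] **THE NEAR-POINT DICHOTOMY.** Let `c` be an ISOLATED double state of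
`z² = a(u₁,…,uₙ)`. Then EITHER (i) there is a set `S` of AT MOST THREE vectors such that the near vector of every
double successor is a multiple of a member of `S`, AND every double successor is ISOLATED with strictly smaller
Milnor number — OR (ii) EVERY double successor is NON-isolated, and the state has corank `e ≥ 3` or is in the
no-tangent class `(e, h₂) = (2, 3)`. (By corank: `e = 0` no successor; `e = 1` one near point, `μ − 2`; `e = 2`,
`h₂ ≤ 2`: `≤ 3` near points by p543928, isolated successors by gen 4; `e = 2`, `h₂ = 3` and `e ≥ 3`: non-isolated
successors, gens 4/3.) The point-blow-up procedure of the route, at an isolated hypersurface double point, is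
thus either finitely branching (`≤ 3`) with a strictly decreasing integer, or leaves the isolated regime at
once. [folklore] -/
theorem hypersurface_near_dichotomy [CharP κ 2] (c : (Fin n → ℕ) → κ) (hM : MultP 2 n κ c) (hI : Isol 2 n κ c) :
    ((∃ S : Finset (Fin n → κ), S.card ≤ 3 ∧
        ∀ (i : Fin n) (τ : Fin n → κ), MultP 2 n κ (step 2 n κ i τ c) →
          ∃ w ∈ S, ∃ r : κ, Function.update τ i 1 = r • w) ∧
      ∀ (i : Fin n) (τ : Fin n → κ), MultP 2 n κ (step 2 n κ i τ c) →
        Isol 2 n κ (step 2 n κ i τ c) ∧ mu 2 n κ (step 2 n κ i τ c) < mu 2 n κ c) ∨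
    ((∀ (i : Fin n) (τ : Fin n → κ), MultP 2 n κ (step 2 n κ i τ c) → ¬ Isol 2 n κ (step 2 n κ i τ c)) ∧
      (3 ≤ milnorEmbDim 2 n κ c ∨ (milnorEmbDim 2 n κ c = 2 ∧ milnorHilbertTwo 2 n κ c = 3))) := by
  rcases Nat.lt_or_ge (milnorEmbDim 2 n κ c) 2 with hlt | hge
  · -- corank `≤ 1`
    obtain ⟨S, hS, hcov⟩ := hypersurface_nearPoints_le_one_of_milnorEmbDim_le_one c hM (by omega)
    exact Or.inl ⟨⟨S, hS.trans (by norm_num), hcov⟩, fun i τ hM' => by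
      obtain ⟨hI', hμ', -⟩ := hypersurface_regime_step c i τ hM hI (by omega) hM'
      exact ⟨hI', by omega⟩⟩
  rcases Nat.lt_or_ge (milnorEmbDim 2 n κ c) 3 with hlt3 | hge3
  · -- corank two: by `h₂`
    have he : milnorEmbDim 2 n κ c = 2 := by omega
    have hr := milnorHilbertTwo_range hM he
    by_cases hh : milnorHilbertTwo 2 n κ c ≤ 2
    · exact Or.inl ⟨hypersurface_nearPoints_le_three_of_milnorHilbertTwo_le_two c hM hI he hh, fun i τ hM' =>
        hypersurface_isol_step_of_milnorHilbertTwo_le_two c i τ hM hI he hh hM'⟩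
    · have h3 : milnorHilbertTwo 2 n κ c = 3 := by omega
      exact Or.inr ⟨fun i τ hM' => hypersurface_not_isol_step_of_milnorHilbertTwo_eq_three c i τ hM he h3 hM',
        Or.inr ⟨he, h3⟩⟩
  · -- corank `≥ 3`
    exact Or.inr ⟨fun i τ hM' => hypersurface_not_isol_step_of_three_le c i τ hM hge3 hM', Or.inl hge3⟩

/-- [OURS · L1 W4.6 rung (ii) at `p = 2`, every dimension, every field of characteristic `2`; NOT a statement of
the manuscript] **THE CENSUS FOR `e ≤ 2`, WITH THE SHARP COUNTS**: an isolated double state with `e(c) ≤ 2` has —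
`e ≤ 1`: at most ONE near double point; `(e, h₂) = (2, 1)`: at most THREE; `(2, 2)`: at most TWO (p544683) — and
in these cases every double successor is isolated with smaller `μ`; or `(e, h₂) = (2, 3)` and every double
successor is non-isolated. [folklore] -/
theorem hypersurface_near_census_of_milnorEmbDim_le_two [CharP κ 2] (c : (Fin n → ℕ) → κ) (hM : MultP 2 n κ c)
    (hI : Isol 2 n κ c) (he : milnorEmbDim 2 n κ c ≤ 2) :
    (∃ S : Finset (Fin n → κ),
        (S.card ≤ 1 ∧ milnorEmbDim 2 n κ c ≤ 1 ∨
          S.card ≤ 3 ∧ milnorEmbDim 2 n κ c = 2 ∧ milnorHilbertTwo 2 n κ c = 1 ∨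
          S.card ≤ 2 ∧ milnorEmbDim 2 n κ c = 2 ∧ milnorHilbertTwo 2 n κ c = 2) ∧
        (∀ (i : Fin n) (τ : Fin n → κ), MultP 2 n κ (step 2 n κ i τ c) →
          ∃ w ∈ S, ∃ r : κ, Function.update τ i 1 = r • w) ∧
        ∀ (i : Fin n) (τ : Fin n → κ), MultP 2 n κ (step 2 n κ i τ c) →
          Isol 2 n κ (step 2 n κ i τ c) ∧ mu 2 n κ (step 2 n κ i τ c) < mu 2 n κ c) ∨
    (milnorEmbDim 2 n κ c = 2 ∧ milnorHilbertTwo 2 n κ c = 3 ∧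
      ∀ (i : Fin n) (τ : Fin n → κ), MultP 2 n κ (step 2 n κ i τ c) → ¬ Isol 2 n κ (step 2 n κ i τ c)) := by
  rcases Nat.lt_or_ge (milnorEmbDim 2 n κ c) 2 with hlt | hge
  · obtain ⟨S, hS, hcov⟩ := hypersurface_nearPoints_le_one_of_milnorEmbDim_le_one c hM (by omega)
    exact Or.inl ⟨S, Or.inl ⟨hS, by omega⟩, hcov, fun i τ hM' => by
      obtain ⟨hI', hμ', -⟩ := hypersurface_regime_step c i τ hM hI (by omega) hM'
      exact ⟨hI', by omega⟩⟩
  · have he2 : milnorEmbDim 2 n κ c = 2 := by omega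
    have hr := milnorHilbertTwo_range hM he2
    have hisol : milnorHilbertTwo 2 n κ c ≤ 2 → ∀ (i : Fin n) (τ : Fin n → κ), MultP 2 n κ (step 2 n κ i τ c) →
        Isol 2 n κ (step 2 n κ i τ c) ∧ mu 2 n κ (step 2 n κ i τ c) < mu 2 n κ c :=
      fun hh i τ hM' => hypersurface_isol_step_of_milnorHilbertTwo_le_two c i τ hM hI he2 hh hM'
    rcases Nat.lt_or_ge (milnorHilbertTwo 2 n κ c) 2 with h1 | h2
    · have hh1 : milnorHilbertTwo 2 n κ c = 1 := by omega
      obtain ⟨S, hS, hcov⟩ := hypersurface_nearPoints_le_three_of_milnorHilbertTwo_le_two c hM hI he2 (by omega)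
      exact Or.inl ⟨S, Or.inr (Or.inl ⟨hS, he2, hh1⟩), hcov, hisol (by omega)⟩
    rcases Nat.lt_or_ge (milnorHilbertTwo 2 n κ c) 3 with h2' | h3
    · have hh2 : milnorHilbertTwo 2 n κ c = 2 := by omega
      obtain ⟨S, hS, hcov⟩ := hypersurface_nearPoints_le_two_of_milnorHilbertTwo_eq_two c hM he2 hh2
      exact Or.inl ⟨S, Or.inr (Or.inr ⟨hS, he2, hh2⟩), hcov, hisol (by omega)⟩
    · have hh3 : milnorHilbertTwo 2 n κ c = 3 := by omega
      exact Or.inr ⟨he2, hh3, fun i τ hM' => hypersurface_not_isol_step_of_milnorHilbertTwo_eq_three c i τ hM he2 hh3 hM'⟩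

/-! ## Fourfolds: order-2-cleaned double points -/

/-- [OURS · L1 W4.6 rung (ii) at `p = 2`, `n = 4`, every field of characteristic `2`; NOT a statement of the
manuscript] **FOURFOLD ORDER-2-CLEANED DOUBLE POINTS: THE COMPLETE ONE-STEP CENSUS.** An isolated double state of
`z² = a(u₀,u₁,u₂,u₃)` whose cleaned series has a quadratic monomial (a hyperbolic pair, `OrdP`) has corank
`e ∈ {0, 2}` (parity, p501431), and: `e = 0` — NO infinitely-near double point (resolved by one blow-up); `e = 2`,
`h₂ = 1` — at most THREE, all isolated with smaller `μ` (free: `μ' = 1`); `e = 2`, `h₂ = 2` — at most TWO, all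
isolated with smaller `μ`; `e = 2`, `h₂ = 3` — every infinitely-near double point NON-isolated (sideways exit).
This is the census of the slot's target class «order-2 cleaned states, n ≥ 3» in dimension four (dimension
three is gen 2/3's regime `e = 1`). [cite: GreuelPfister2026, Thm 3.5 and Cor 3.7] -/
theorem fourfold_ordTwo_near_census [CharP κ 2] (c : (Fin 4 → ℕ) → κ) (hM : MultP 2 4 κ c) (hI : Isol 2 4 κ c)
    (hO : OrdP 2 4 κ c) :
    (milnorEmbDim 2 4 κ c = 0 ∧ ∀ (i : Fin 4) (τ : Fin 4 → κ), ¬ MultP 2 4 κ (step 2 4 κ i τ c)) ∨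
    (milnorEmbDim 2 4 κ c = 2 ∧ milnorHilbertTwo 2 4 κ c ≤ 2 ∧
      (∃ S : Finset (Fin 4 → κ), (S.card ≤ 3 ∧ milnorHilbertTwo 2 4 κ c = 1 ∨ S.card ≤ 2 ∧ milnorHilbertTwo 2 4 κ c = 2) ∧
        ∀ (i : Fin 4) (τ : Fin 4 → κ), MultP 2 4 κ (step 2 4 κ i τ c) →
          ∃ w ∈ S, ∃ r : κ, Function.update τ i 1 = r • w) ∧
      ∀ (i : Fin 4) (τ : Fin 4 → κ), MultP 2 4 κ (step 2 4 κ i τ c) →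
        Isol 2 4 κ (step 2 4 κ i τ c) ∧ mu 2 4 κ (step 2 4 κ i τ c) < mu 2 4 κ c) ∨
    (milnorEmbDim 2 4 κ c = 2 ∧ milnorHilbertTwo 2 4 κ c = 3 ∧
      ∀ (i : Fin 4) (τ : Fin 4 → κ), MultP 2 4 κ (step 2 4 κ i τ c) → ¬ Isol 2 4 κ (step 2 4 κ i τ c)) := by
  have hp := milnorEmbDim_le_and_mod_two hM
  have he2 : milnorEmbDim 2 4 κ c + 2 ≤ 4 := (ordP_iff_milnorEmbDim_add_two_le hM).mp hO
  -- `e` is even and `≤ 2`: `e = 0` or `e = 2`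
  have hcases : milnorEmbDim 2 4 κ c = 0 ∨ milnorEmbDim 2 4 κ c = 2 := by
    have h2 := hp.2.1
    omega
  rcases hcases with h0 | h2
  · exact Or.inl ⟨h0, hypersurface_not_multP_step_of_milnorEmbDim_eq_zero c hM h0⟩
  · rcases hypersurface_near_census_of_milnorEmbDim_le_two c hM hI (by omega) with ⟨S, hS, hcov, hisol⟩ | ⟨-, h3, hno⟩
    · refine Or.inr (Or.inl ⟨h2, ?_, ⟨S, ?_, hcov⟩, hisol⟩)
      · rcases hS with ⟨-, h⟩ | ⟨-, -, h⟩ | ⟨-, -, h⟩ <;> omega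
      · rcases hS with ⟨-, h⟩ | ⟨hS3, -, h1⟩ | ⟨hS2, -, hh2⟩
        · omega
        · exact Or.inl ⟨hS3, h1⟩
        · exact Or.inr ⟨hS2, hh2⟩
    · exact Or.inr (Or.inr ⟨h2, h3, hno⟩)

end CampaignW46.HypersurfacesCharTwo

end Summit.ResolutionOfSingularities.ResolutionOfSingularities.Theorems

end
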